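import Mathlib
import HarnessLib

/-!
# CM Manin period II — separating idempotents in Henselian subalgebras of products of local rings (algebraic kernel of stub P4
# `inertRigidity` of the line card `cm-manin-period`; seed crux `SignedMuSeedAtTwoPlus` stmt-BirchSwinnertonDyer-21438, parent Kμ⁺
# stmt-BirchSwinnertonDyer-20689, route ResidualThetaTransportAtTwo; card `Cruxes/SignedMuSeedAtTwoPlus/Ideas/cm-manin-period.md`, step (c))

Cell `bsd-wall`, width seat `bsd-wall-rtt-p4-w2` g16 (`--supports`, closes nothing).  THEOREMS ONLY; BSD is not proved by this.

Step (c) of the card («inert rigidity»: `𝒪_K ⊗ ℤ₂ ⊆ End(B) ⊗ ℤ₂`) argues: the commutative algebra `S = O_L[ρ_B(G_K)] ⊆ ∏_τ O_L` generated by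
the Galois image has, RESIDUALLY, an idempotent separating the two `K`-embedding classes of `τ` (the residual characters differ there), and
this idempotent lies in `S` itself.  The passage «residual idempotent ⇒ idempotent of `S`» is idempotent lifting in a Henselian pair; this
file isolates it over an arbitrary local ring `O`, a subring `S` of the product ring `ι → O`, and an ideal `J` of `S` with `(S, J)` Henselian
(e.g. `S` `J`-adically complete: Mathlib's instance `IsAdicComplete.henselianRing`) whose elements have coordinates in the maximal ideal of `O`:

* **`exists_isIdempotentElem_sub_mem`** — in a Henselian pair `(S, J)`, every `t` with `t² − t ∈ J` is congruent mod `J` to an idempotent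
  (Hensel for `X² − X`: the derivative `2t − 1` squares to `4(t² − t) + 1 ≡ 1`);
* `isIdempotentElem_apply`, `eq_zero_or_eq_one_of_isIdempotentElem` — coordinates of an idempotent of `ι → O` are idempotents of the LOCAL
  ring `O`, hence `0` or `1`;
* **`exists_separating_idempotent`** — for `t ∈ S` with `t² − t ∈ J` there is an idempotent `e ∈ S` with `e i = 1 ⟺ t i − 1 ∈ 𝔪_O` and
  `e i = 0 ⟺ t i ∈ 𝔪_O`;
* **`indicator_mem_of_henselian`** — consequently the INDICATOR function of `{i | t i ≡ 1 (mod 𝔪_O)}` belongs to `S` (the card's «the idempotent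
  separating the two `K`-embedding classes lies in `ℤ₂[ρ_B(G_K)] ⊗ ℤ̄₂`», given a Galois element `t = ρ(Frob_α)`-polynomial with residues
  `1` on one class and `0` on the other).

What the consumer still owes: the Henselian hypothesis for the concrete `S` (module-finite over a complete `O_L` ⇒ `𝔪S`-adically complete ⇒
Henselian at `J = 𝔪S`, coordinates of `𝔪S` lie in `𝔪`), and the residual separation (characters `x ↦ x`, `x ↦ x²` differ on `𝔽₄ˣ`). [folklore]
-/

set_option autoImplicit false
-- the Theorems namespace of this sub repeats the summit name by design (D-0017 nested layout)
set_option linter.dupNamespace false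

open Polynomial

namespace Summit.BirchSwinnertonDyer.BirchSwinnertonDyer.Theorems.SignedMuAtTwo.CMManinPeriod

/-! ## Idempotent lifting in a Henselian pair -/

section Lift

variable {S : Type*} [CommRing S] (J : Ideal S) [HenselianRing S J]

/-- **Idempotents lift in a Henselian pair**: if `t * t − t ∈ J` then some idempotent `e` has `e − t ∈ J`
(Hensel's lemma for the monic `X² − X`, whose derivative at `t` is `2t − 1` with `(2t − 1)² = 4(t² − t) + 1 ≡ 1 (mod J)`). [folklore] -/
theorem exists_isIdempotentElem_sub_mem (t : S) (ht : t * t - t ∈ J) :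
    ∃ e : S, IsIdempotentElem e ∧ e - t ∈ J := by
  rcases subsingleton_or_nontrivial S with hS | hS
  · exact ⟨t, Subsingleton.elim _ _, by rw [sub_self]; exact J.zero_mem⟩
  have hmonic : (X ^ 2 - X : S[X]).Monic := by
    refine (monic_X_pow 2).sub_of_left ?_
    rw [degree_X_pow, degree_X]
    norm_num
  have heval : (X ^ 2 - X : S[X]).eval t ∈ J := by
    simpa [sq] using ht
  have hder : IsUnit (Ideal.Quotient.mk J ((X ^ 2 - X : S[X]).derivative.eval t)) := by
    have hd : (X ^ 2 - X : S[X]).derivative.eval t = (1 + 1) * t - 1 := by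
      simp
    rw [hd]
    have hsq : Ideal.Quotient.mk J ((1 + 1) * t - 1) * Ideal.Quotient.mk J ((1 + 1) * t - 1) = 1 := by
      rw [← map_mul, ← map_one (Ideal.Quotient.mk J), Ideal.Quotient.eq]
      have h4 : ((1 + 1) * t - 1) * ((1 + 1) * t - 1) - 1 = 4 * (t * t - t) := by ring
      rw [h4]
      exact J.mul_mem_left 4 ht
    exact IsUnit.of_mul_eq_one _ hsq
  obtain ⟨e, he, heJ⟩ := HenselianRing.is_henselian (X ^ 2 - X) hmonic t heval hder
  refine ⟨e, ?_, heJ⟩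
  have h0 : e ^ 2 - e = 0 := by simpa using he
  have h1 : e * e = e := by
    rw [← sq]
    exact sub_eq_zero.mp h0
  exact h1

end Lift

/-! ## Coordinates of idempotents in a product of local rings -/

section Coordinates

variable {ι O : Type*} [CommRing O]

/-- Coordinates of an idempotent of the product ring `ι → O` are idempotent. [folklore] -/
theorem isIdempotentElem_apply {e : ι → O} (he : IsIdempotentElem e) (i : ι) : IsIdempotentElem (e i) := by
  have h := congrFun he i
  simpa [IsIdempotentElem] using h

/-- In a local ring an idempotent is `0` or `1` (one of `e`, `1 − e` is a unit and `e(1 − e) = 0`). [folklore] -/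
theorem eq_zero_or_eq_one_of_isIdempotentElem [IsLocalRing O] {e : O} (he : IsIdempotentElem e) : e = 0 ∨ e = 1 := by
  have hz : e * (1 - e) = 0 := by rw [mul_sub, mul_one, he.eq, sub_self]
  rcases IsLocalRing.isUnit_or_isUnit_one_sub_self e with hu | hu
  · right
    have h := hu.mul_right_eq_zero.mp hz
    linear_combination -h
  · left
    exact hu.mul_left_eq_zero.mp hz

end Coordinates

/-! ## Separating idempotents lie in Henselian subalgebras -/

section Separating

variable {ι O : Type*} [CommRing O] [IsLocalRing O] (S : Subring (ι → O)) (J : Ideal S) [HenselianRing S J]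

/-- **Separating idempotent.**  Let `S` be a subring of the product `ι → O` of copies of a local ring, `J` an ideal of `S` with `(S, J)`
Henselian and with coordinates in `𝔪_O` (`s ∈ J ⇒ s i ∈ 𝔪_O`).  If `t ∈ S` satisfies `t² − t ∈ J` then `S` contains an idempotent `e` whose
coordinates are `e i = 1` exactly where `t i ≡ 1 (mod 𝔪_O)` and `e i = 0` exactly where `t i ∈ 𝔪_O`. [folklore] -/
theorem exists_separating_idempotent (hJ : ∀ s ∈ J, ∀ i, (s : ι → O) i ∈ IsLocalRing.maximalIdeal O)
    (t : S) (ht : t * t - t ∈ J) :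
    ∃ e : S, IsIdempotentElem e ∧
      ∀ i, (((e : ι → O) i = 1 ↔ (t : ι → O) i - 1 ∈ IsLocalRing.maximalIdeal O) ∧
            ((e : ι → O) i = 0 ↔ (t : ι → O) i ∈ IsLocalRing.maximalIdeal O)) := by
  obtain ⟨e, he, heJ⟩ := exists_isIdempotentElem_sub_mem J t ht
  refine ⟨e, he, fun i => ?_⟩
  have hcoord : IsIdempotentElem ((e : ι → O) i) := by
    have h1 : IsIdempotentElem (e : ι → O) := by
      have h2 := congrArg (fun x : S => (x : ι → O)) he.eq
      simpa [IsIdempotentElem, Subring.coe_mul] using h2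
    exact isIdempotentElem_apply h1 i
  have hdiff : (e : ι → O) i - (t : ι → O) i ∈ IsLocalRing.maximalIdeal O := by
    have h := hJ _ heJ i
    simpa [AddSubgroupClass.coe_sub] using h
  have hne : (1 : O) ∉ IsLocalRing.maximalIdeal O :=
    fun h => (IsLocalRing.mem_maximalIdeal 1).mp h isUnit_one
  rcases eq_zero_or_eq_one_of_isIdempotentElem hcoord with h0 | h1
  · -- e i = 0: then t i ∈ 𝔪 and t i - 1 ∉ 𝔪
    rw [h0, zero_sub] at hdiff
    have ht𝔪 : (t : ι → O) i ∈ IsLocalRing.maximalIdeal O := by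
      simpa using (IsLocalRing.maximalIdeal O).neg_mem hdiff
    refine ⟨⟨fun h => absurd (h0.symm.trans h) zero_ne_one, fun h => ?_⟩, ⟨fun _ => ht𝔪, fun _ => h0⟩⟩
    exact absurd (by simpa using (IsLocalRing.maximalIdeal O).sub_mem ht𝔪 h) hne
  · -- e i = 1: then t i - 1 ∈ 𝔪 and t i ∉ 𝔪
    rw [h1] at hdiff
    have ht1 : (t : ι → O) i - 1 ∈ IsLocalRing.maximalIdeal O := by
      simpa using (IsLocalRing.maximalIdeal O).neg_mem hdiff
    refine ⟨⟨fun _ => ht1, fun _ => h1⟩, ⟨fun h => absurd (h1.symm.trans h) one_ne_zero, fun h => ?_⟩⟩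
    exact absurd (by simpa using (IsLocalRing.maximalIdeal O).sub_mem h ht1) hne

/-- **The indicator of a residue class lies in `S`.**  Under the hypotheses of `exists_separating_idempotent`, and if every coordinate of
`t` is `≡ 0` or `≡ 1 (mod 𝔪_O)`, the function `i ↦ if t i ≡ 1 then 1 else 0` is an element of `S` (the card's «idempotent separating the two
`K`-embedding classes lies in the Galois algebra»). [folklore] -/
theorem indicator_mem_of_henselian (hJ : ∀ s ∈ J, ∀ i, (s : ι → O) i ∈ IsLocalRing.maximalIdeal O)
    (t : S) (ht : t * t - t ∈ J)
    [DecidablePred fun i : ι => (t : ι → O) i - 1 ∈ IsLocalRing.maximalIdeal O] :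
    (fun i => if (t : ι → O) i - 1 ∈ IsLocalRing.maximalIdeal O then (1 : O) else 0) ∈ S := by
  obtain ⟨e, _, hcoord⟩ := exists_separating_idempotent S J hJ t ht
  have hfun : (fun i => if (t : ι → O) i - 1 ∈ IsLocalRing.maximalIdeal O then (1 : O) else 0) = (e : ι → O) := by
    funext i
    by_cases h : (t : ι → O) i - 1 ∈ IsLocalRing.maximalIdeal O
    · rw [if_pos h]
      exact ((hcoord i).1.mpr h).symm
    · rw [if_neg h]
      -- then e i ≠ 1, so e i = 0 (coordinates are 0 or 1)
      rcases eq_zero_or_eq_one_of_isIdempotentElem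
          (isIdempotentElem_apply (e := (e : ι → O)) (by
            have h2 := congrArg (fun x : S => (x : ι → O)) ‹IsIdempotentElem e›.eq
            simpa [IsIdempotentElem, Subring.coe_mul] using h2) i) with h0 | h1
      · exact h0.symm
      · exact absurd ((hcoord i).1.mp h1) h
  rw [hfun]
  exact e.prop

end Separating

end Summit.BirchSwinnertonDyer.BirchSwinnertonDyer.Theorems.SignedMuAtTwo.CMManinPeriod
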